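import Literature.Topology.FourManifolds.LatticeFormsIndefinite
import Literature.Topology.FourManifolds.LatticeFormsRepresentsZeroProofs
import HarnessLib

/-!
# The classification of indefinite unimodular lattices (Serre V §2.2 Thm. 6) holds

Trunk T-4MAN; sibling proof file of `LatticeFormsIndefinite.lean` and `LatticeForms.lean`
(namespace `LinearMap.BilinForm`). One fully proved theorem: the **discharge** of the named fact
`equivalent_of_isIndefinite` of `LatticeForms.lean` — Serre, *A Course in Arithmetic*, Ch. V
§2.2 Thm. 6 (Milnor–Husemoller, *Symmetric bilinear forms*, II Thm. 5.3): *two symmetric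
unimodular indefinite lattices with the same rank, signature and type are isometric.*

The structural part of Serre's proof (Ch. V §3.2–§3.5: Lemmas 1–6, Thm. 4, Thm. 5) is
`equivalent_of_isIndefinite_of_exists_isotropic` (`LatticeFormsIndefinite.lean` and its imports),
which reduces Thm. 6 to Thm. 3 ("an indefinite unimodular lattice represents zero", the named fact
`exists_isotropic_of_isIndefinite`); Thm. 3 is now proved (`exists_isotropic_of_isIndefinite_holds`,
`LatticeFormsRepresentsZeroProofs.lean`: reduction theory in ranks `≤ 5` and Meyer's theorem —
Hasse–Minkowski over `ℚ`, `Literature/NumberTheory/QuadraticForms/` — in ranks `≥ 5`; a second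
route through Hasse–Minkowski in ranks `3, 4` is `UnimodularIsotropy.lean`).

## Sources

* J.-P. Serre, *A Course in Arithmetic* (GTM 7, Springer 1973), Ch. V §2.2 Thm. 6, §3
  (PDF pp. 53–58). [Serre1973]
* J. Milnor, D. Husemoller, *Symmetric bilinear forms* (Springer 1973), Ch. II §5, Thm. 5.3.
  [MilnorHusemoller1973]
-/

open Module
open LinearMap (BilinForm)

universe u v

namespace LinearMap.BilinForm

variable {V : Type u} {V' : Type v} [AddCommGroup V] [Module ℤ V] [AddCommGroup V'] [Module ℤ V']
  {Q : LinearMap.BilinForm ℤ V} {Q' : LinearMap.BilinForm ℤ V'}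

/-- **The classification of indefinite unimodular lattices holds** (discharge of the named fact
`equivalent_of_isIndefinite` of `LatticeForms.lean`): two symmetric unimodular indefinite lattices
with the same rank, signature and type (parity) are isometric — Serre, *A Course in Arithmetic*,
Ch. V §2.2 Thm. 6 (with Thm. 4, Thm. 5 and §3); Milnor–Husemoller (1973) II Thm. 5.3. Assembled
from Serre's Theorem 3 (`exists_isotropic_of_isIndefinite_holds`) by
`equivalent_of_isIndefinite_of_exists_isotropic`. [cite: Serre1973, Ch. V §2.2 Thm. 6] -/
theorem equivalent_of_isIndefinite_holds : equivalent_of_isIndefinite (Q := Q) (Q' := Q') :=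
  equivalent_of_isIndefinite_of_exists_isotropic exists_isotropic_of_isIndefinite_holds

end LinearMap.BilinForm
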